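import Literature.AlgebraicGeometry.Motives.MilneRationalityConjecture
import Literature.AlgebraicGeometry.Motives.AbelianVarietyBaseChange
import Literature.AlgebraicGeometry.Motives.AbelianVarietyProjectiveChart
import Literature.AlgebraicGeometry.HodgeTheory.ComplexConjugationHolds
import Summits.HodgeConjecture.HodgeConjecture.Theses.RankFourFaces
import Summits.HodgeConjecture.HodgeConjecture.Theses.PadicSemiregularLift
import Summits.HodgeConjecture.HodgeConjecture.Theses.PeriodDeficiency
import Summits.HodgeConjecture.HodgeConjecture.Theorems.Ring2HypothesesDescent
import HarnessLib

/-!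
# Ring 2 · §deform · part V — ARITHMETIC Principle B (row A): spreading algebraicity from the
# CM points THROUGH THE SPECIAL FIBRE

HONEST FRAMING (page 1, as in parts I–IV). This is a RESEARCH ROUTE CONDITIONAL ON `HC_CM`
(`RankFourFaces.CMAbelianHodge`, an OPEN item, a BINDER everywhere below, never a fact); nothing
here is a corollary of anything proved; Markman's Question 11.4 sentence 2 is already REFUTED in
dimension ≥ 3 (semiregular-propagation v7) and is not used. No internally minted statement enters
as a cited fact: every junction with print is an explicit hypothesis of the theorem that uses it.

THE AXIS. Parts I–IV spread algebraicity from the dense CM points along the COMPLEX base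
(variational Hodge; printed verdict: the only printed way back from `HC_CM` to `HC_AV` is a
variational statement, open beyond divisors). Part V replaces the complex disc by `Spec O`, `O` a
prime of `ℚ̄`: a Hodge class `t` on `A/ℚ̄` is specialised to the reduction `A₀/𝔽̄_p` of a smooth
proper model (Milne's carriers `MilneRealizationData.specializeBetti`, [Milne2009RationalTate,
§3.1]); `HC_CM` makes the specialisation ALGEBRAIC there, and the input that must spread
algebraicity back to characteristic zero is a *p-adic lifting* statement. Printed anchors:
* [Milne1999, Thm 7.1] (`Literature.AlgebraicGeometry.Milne1999.Theorem71`): `HC_CM` ⟹ the Tate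
  conjecture for all abelian varieties over `𝔽̄_p` (all `p`);
* [Deligne1982HodgeCycles, 2.9(b)] + [Milne2009RationalTate, §3.1 p. 13]: "Gal(ℚ^al/ℚ) acts on
  𝓑*(A) through a finite quotient, and so the Hodge classes on A are Tate classes. Therefore, they
  specialize to Tate classes on A₀" — with Milne 7.1 this is junction `hJ` below: under `HC_CM`
  every specialised Hodge class lies in the `ℚ_ℓ`-SPAN of cycle classes (node
  `SpecialisationsAlgebraicAV`);
* [Milne2009RationalTate, Aside 4.6 p. 19] (special lift, proved up to isogeny for Shimura
  varieties of Hodge type with hyperspecial level at `p > 2` by [Kisin2017]): "given an abelian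
  variety A over ℚ^al with good reduction to A₀ over 𝔽 and a Hodge class γ on A, there exists a
  CM abelian variety A′ over ℚ^al and a Hodge class γ′ on A′ for which there exists an isogeny
  A′₀ → A₀ sending γ′₀ to γ₀" (restated with the attribution "results of Kisin and Vasiu" in
  [Milne2025AbelianMotivesCharP, §6.2] = arXiv:2508.09972, an UNREFEREED PREPRINT, cited in this
  file for statements and status only: "γ_ℓ maps to γ′_ℓ for all γ") — with `HC_CM` applied to
  `A′` this is junction `hJ'`: the specialisation is the class of a RATIONAL cycle (node
  `SpecialisationsRationalAV`, cofinitely many `p`, where the special-lift theorem applies);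
* [Milne2009RationalTate, §4.1 p. 18]: the rationality conjecture "is implied by the Hodge
  conjecture for abelian varieties (or even by the weaker statement that the Hodge classes
  specialize to algebraic classes)"; = Conjecture A of [Milne2025AbelianMotivesCharP, §3]
  (unrefereed), known for CM `A` with simple ORDINARY reduction (3.3), open otherwise ("Beyond
  that, I have no idea", p. 14); its weak form Conjecture B (§4: weakly w-Lefschetz ⟹ w-Lefschetz)
  is what a supersingular prime needs, and the proof of B for CM abelian varieties in §4.10 there
  is conditional (§4.10, first sentence: "Assuming that the proof of Theorem (c15) has been
  completed" — the label is an unresolved cross-reference in the arXiv source; §4.16);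
* the p-adic variational Hodge conjecture [BlochEsnaultKerz2014pAdic, Conj. 2] ("no analog of
  the absolute Hodge conjecture … would comprise the p-adic VHC", p. 3; cf.
  [AntieauMathewMorrowNikolaus2022, Conj. 1.3]) is the printed NEIGHBOUR of node
  `RationalLiftingAtOnePrimeAV`: same direction, but BEK lift a `K₀`-class over `W(k)` under a
  crystalline filtration condition, whereas the node is class-level on the generic fibre,
  carries "`t` is Hodge" as hypothesis, and reads algebraicity of `γ₀` `ℓ`-adically.

ROWS (`𝔇` = a family of Milne realization data, DATA quantified as an explicit binder; every KIND
label is for `𝔇` satisfying the junctions `hJ`/`hJ'` — a degenerate `𝔇`, e.g. `specializeBetti =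
0`, makes node `L` literally `HC_QbarAV`; a row's content is the PAIR (junction, node) for one `𝔇`):
* row A  (span form, KIND 2 = complementary to `HC_CM`):
  `HC_QbarAV_of_HC_CM_and_spanLifting : (HC_CM → SpecialisationsAlgebraicAV 𝔇) → HC_CM →
   SpanLiftingAtAlmostAllPrimesAV 𝔇 → HodgeConjectureQbarAV`, exact
  (`HC_QbarAV_iff_HC_CM_and_spanLifting`) modulo `hJ` and `hQC : HC_QbarAV → HC_CM` (CM abelian
  varieties are defined over `ℚ̄`, [Shimura1998, §12 Prop. 26]);
* row A′ (rational form): `HC_QbarAV_of_HC_CM_and_rationalLifting`, with `hJ'` and the classical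
  junction `hgood` (every `A/ℚ̄` has smooth proper models at almost all `p`: spreading out
  [StacksProject, Tags 0C0C, 081F] and [SerreTate1968, §1]; nearest tree fact
  `exists_finite_hasGoodReductionOutside`, number-field form);
* NO-GO (KIND 1 = dominating): the SINGLE-PRIME span form `SpanLiftingAtOnePrimeAV` proves, with
  no `HC_CM` at all, the Hodge conjecture for every `A/ℚ̄` having ONE reduction all of whose classes
  are spanned by cycle classes (`algebraic_of_spanLiftingAtOnePrime_of_algebraicClasses_eq_top`);
  every CM abelian variety has such (supersingular) reductions — potential good reduction
  [SerreTate1968, Thm. 6], then [Shimura1998, §13 Thm. 1] + Chebotarev: the primes whose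
  Frobenius in the Galois closure `L` of the CM field is complex conjugation have density
  ≥ 1/[L:ℚ] and give supersingular reduction; all classes there are
  Lefschetz (`LenstraZarhin1993_supersingular_lefschetzClasses_eq_top.algebraicClasses_eq_top`) —
  so that node swallows `HC_CM` exactly as the blanket p-adic / semiregular inputs of rows D/M did.
  The rational single-prime form escapes this ONLY because Conjecture B is open: honest kind
  "2 today, 1 the day Conjecture B of [Milne2025AbelianMotivesCharP, §4] (unrefereed preprint; its
  §4.10 proof for CM abelian varieties is conditional, first sentence) is a theorem for CM abelian
  varieties".

HONEST COLUMN. (a) Endpoint is `HodgeConjectureQbarAV` (abelian varieties definable over `ℚ̄`),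
not `HC_AV`: `HodgeConjecture → HC_AV → HC_QbarAV` is proved here, and so is
`PeriodDeficiency.HodgeConjectureQbar → HC_QbarAV` modulo the refereed facts Deligne 1982 Thm 2.11 +
Voisin 2007 Prop. 1.2; `HC_QbarAV → HC_AV` for abelian varieties alone is not in print. (b) `hJ`,
`hJ'`, `hgood`, `hQC` are print chains kept as inline binders, never Literature facts (Milne's
`SpecializationData` carries no Galois equivariance / cycle-class compatibility). (c) No lifting
node is implied by `HC_CM` plus anything in print; each is implied by `HodgeConjectureQbarAV` (on
path, proved). (d) `L₁` is the philosophy of route `PadicSemiregularLift`. RING2-MAP D.16–D.22.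
-/

set_option linter.dupNamespace false

noncomputable section

open CategoryTheory AlgebraicGeometry
open scoped TensorProduct
open Literature.AlgebraicTopology.SingularHomology Literature.AlgebraicGeometry.Motives
open Literature.AlgebraicGeometry.HodgeTheory

namespace Summit.HodgeConjecture.HodgeConjecture.Ring2.Deform

local notation "ℚal" => IntermediateField.toSubfield (algebraicClosure ℚ ℂ)
local notation "HC_CM" => Summit.HodgeConjecture.HodgeConjecture.Theses.RankFourFaces.CMAbelianHodge
local notation "HC_AV" =>
  Summit.HodgeConjecture.HodgeConjecture.Theses.PadicSemiregularLift.HodgeAbelianVarieties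

/-! ## Carriers (data; no statement is hidden in them) -/
/-- A family of Milne realization data [Milne2009RationalTate, §3.1] (`MilneRealizationData`:
realizations, Artin comparison, smooth-proper specialization maps) at every prime `O` of `ℚ̄`.
DATA, always an explicit binder `(𝔇 : RealizationFamily)`, never quantified inside a node. -/
abbrev RealizationFamily : Type 1 :=
  ∀ (p : ℕ) [Fact p.Prime] (O : ValuationSubring ℚal) [CharP (IsLocalRing.ResidueField O) p],
    MilneRealizationData ℚal p O

variable (𝔇 : RealizationFamily)

/-- The specialisation `γ₀ ∈ H^{2r}_ℓ(A₀)` [Milne2009RationalTate, §3.1] of the Betti class of a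
rational cocycle `ζ` on `A_ℂ` at a model `𝒜` of `A/ℚ̄` over the prime `O`
(`MilneRealizationData.specializeBetti`, read in `H^{2r}_ℓ(A₀)` through `ℚ_ℓ ⊗_{ℚ_ℓ} H ≅ H`). -/
def specialisedClass {p : ℕ} [Fact p.Prime] {O : ValuationSubring ℚal}
    [CharP (IsLocalRing.ResidueField O) p] {A : AbelianVariety ℚal} (𝒜 : IntegralModel O ℚal A.X)
    (r ℓ : ℕ) [Fact ℓ.Prime] (hℓ : ℓ ≠ p)
    (ζ : singularCochainComplex.cocycles ℚ ℚ (ComplexPoints (A.baseChange ℂ).X) (2 * r)) :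
    ((𝔇 p O).E₀ ℓ hℓ).obj 𝒜.specialFibre (2 * r) :=
  TensorProduct.lid ℚ_[ℓ] _
    ((𝔇 p O).specializeBetti ℓ hℓ 𝒜 (2 * r)
      (((𝔇 p O).P.B.isoObj _ (2 * r)).symm (singularCohomology.π ℚ ℚ _ (2 * r) ζ)))

/-! ## Nodes (every `Prop` here is an OPEN statement, tagged `@[conjecture]`) -/

/-- ENDPOINT. The Hodge conjecture for abelian varieties definable over `ℚ̄`: for every abelian
variety `A` over `ℚ^al ⊂ ℂ`, `HodgeConjectureFor` its complexification. Implied by `HC_AV`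
(`hodgeConjectureQbarAV_of_HC_AV`); the converse for abelian varieties alone is not in print. -/
@[conjecture] def HodgeConjectureQbarAV : Prop :=
  ∀ A : AbelianVariety ℚal, HodgeConjectureFor A.dim (A.baseChange ℂ).X

/-- JUNCTION TARGET `J` (span form). For every abelian variety `A/ℚ̄`, every Hodge class on `A_ℂ`
(a rational cocycle of type `(r,r)`), every prime `O` of `ℚ̄` and every smooth proper model `𝒜`
of `A` over `O`: the specialisation `γ₀` lies in the `ℚ_ℓ`-span of the classes of algebraic cycles
on the special fibre, for every `ℓ ≠ p`. PRINT: a consequence of `HC_CM` by [Milne1999, Thm 7.1]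
(Tate for abelian varieties over `𝔽̄_p`) and [Deligne1982HodgeCycles, 2.9(b)] ("Hodge classes are
Tate classes, therefore they specialize to Tate classes", [Milne2009RationalTate, §3.1 p. 13]) —
entered below ONLY as the inline binder `hJ : HC_CM → SpecialisationsAlgebraicAV 𝔇`. Open
(Tate-type content; `HC_QbarAV` gives it only with a cycle-class compatibility of `sp` that Milne's
data does not carry). -/
@[conjecture] def SpecialisationsAlgebraicAV : Prop :=
  ∀ (A : AbelianVariety ℚal) (r : ℕ)
    (ζ : singularCochainComplex.cocycles ℚ ℚ (ComplexPoints (A.baseChange ℂ).X) (2 * r)),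
    IsOfHodgeType A.dim (A.baseChange ℂ).X (2 * r) r r
        (singularCohomology.π ℂ ℂ _ (2 * r) (cocycleOfRat _ (2 * r) ζ)) →
    ∀ (p : ℕ) [Fact p.Prime] (O : ValuationSubring ℚal) [CharP (IsLocalRing.ResidueField O) p]
      (𝒜 : IntegralModel O ℚal A.X), 𝒜.IsSmoothProper A.dim →
    ∀ (ℓ : ℕ) [Fact ℓ.Prime] (hℓ : ℓ ≠ p),
      specialisedClass 𝔇 𝒜 r ℓ hℓ ζ ∈ ((𝔇 p O).E₀ ℓ hℓ).algebraicClasses 𝒜.specialFibre r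

/-- JUNCTION TARGET `J′` (rational form). For every `A/ℚ̄` and every Hodge class on `A_ℂ` there
is a finite set `F` of primes such that at every prime `O` of residue characteristic `p ∉ F` and
every smooth proper model over `O`, `γ₀` is the class of an algebraic cycle WITH RATIONAL
COEFFICIENTS (`PreWeilCohomology.ratAlgebraicClasses`), for every `ℓ ≠ p`. PRINT: a consequence
of `HC_CM` by the special lift [Milne2009RationalTate, Aside 4.6] ([Kisin2017];
[Milne2025AbelianMotivesCharP, §6.2]) applied to the class and `HC_CM` on the CM lift `A′`;
entered ONLY as the inline binder `hJ' : HC_CM → SpecialisationsRationalAV 𝔇`. -/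
@[conjecture] def SpecialisationsRationalAV : Prop :=
  ∀ (A : AbelianVariety ℚal) (r : ℕ)
    (ζ : singularCochainComplex.cocycles ℚ ℚ (ComplexPoints (A.baseChange ℂ).X) (2 * r)),
    IsOfHodgeType A.dim (A.baseChange ℂ).X (2 * r) r r
        (singularCohomology.π ℂ ℂ _ (2 * r) (cocycleOfRat _ (2 * r) ζ)) →
    ∃ F : Finset ℕ, ∀ (p : ℕ) [Fact p.Prime], p ∉ F →
      ∀ (O : ValuationSubring ℚal) [CharP (IsLocalRing.ResidueField O) p]
        (𝒜 : IntegralModel O ℚal A.X), 𝒜.IsSmoothProper A.dim →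
      ∀ (ℓ : ℕ) [Fact ℓ.Prime] (hℓ : ℓ ≠ p),
        specialisedClass 𝔇 𝒜 r ℓ hℓ ζ ∈ ((𝔇 p O).E₀ ℓ hℓ).ratAlgebraicClasses 𝒜.specialFibre r

/-- INPUT NODE `L` — SPAN LIFTING AT ALMOST ALL PRIMES (KIND 2, complementary to `HC_CM`, for `𝔇`
satisfying the junction `hJ`; a degenerate `𝔇`, e.g. `specializeBetti = 0`, makes it literally
`HodgeConjectureQbarAV`). A Hodge class on `A/ℚ̄` whose specialisation lies in the `ℚ_ℓ`-span of
cycle classes at EVERY smooth proper model over every prime outside some finite set (all `ℓ ≠ p`)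
is algebraic. Why KIND 2: the hypothesis is free at supersingular primes (Lenstra–Zarhin) but every
CM abelian variety also has a positive density of primes of ordinary reduction (those splitting
completely in the Galois closure of the reflex field), where "`γ₀` is spanned by cycle classes" is
Tate-conjecture content, so the node does not visibly prove `HC_CM`; conversely `HC_CM` gives the
hypothesis (junction `J`), not the conclusion. Cost: an arithmetic Principle B for algebraicity —
closest print [BlochEsnaultKerz2014pAdic, Conj. 2], proved for line bundles and, for `p > dim + 6`
over `W(k)`, up to algebraisation of a formal pro-`K₀`-class (Thm. 1, remarks (i)–(iii)). On path:
implied by `HodgeConjectureQbarAV` (proved below). -/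
@[conjecture] def SpanLiftingAtAlmostAllPrimesAV : Prop :=
  ∀ (A : AbelianVariety ℚal) (r : ℕ)
    (ζ : singularCochainComplex.cocycles ℚ ℚ (ComplexPoints (A.baseChange ℂ).X) (2 * r)),
    IsOfHodgeType A.dim (A.baseChange ℂ).X (2 * r) r r
        (singularCohomology.π ℂ ℂ _ (2 * r) (cocycleOfRat _ (2 * r) ζ)) →
    (∃ F : Finset ℕ, ∀ (p : ℕ) [Fact p.Prime], p ∉ F →
      ∀ (O : ValuationSubring ℚal) [CharP (IsLocalRing.ResidueField O) p]
        (𝒜 : IntegralModel O ℚal A.X), 𝒜.IsSmoothProper A.dim →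
      ∀ (ℓ : ℕ) [Fact ℓ.Prime] (hℓ : ℓ ≠ p),
        specialisedClass 𝔇 𝒜 r ℓ hℓ ζ ∈ ((𝔇 p O).E₀ ℓ hℓ).algebraicClasses 𝒜.specialFibre r) →
    singularCohomology.π ℂ ℂ _ (2 * r) (cocycleOfRat _ (2 * r) ζ) ∈
      algebraicClasses (A.baseChange ℂ).X r

/-- INPUT NODE `L₁` — SPAN LIFTING AT ONE PRIME (KIND 1: it DOMINATES `HC_CM`, see the no-go
`algebraic_of_spanLiftingAtOnePrime_of_algebraicClasses_eq_top`). A Hodge class on `A/ℚ̄` whose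
specialisation at ONE smooth proper model over one prime `O` lies in the `ℚ_ℓ`-span of cycle
classes (all `ℓ ≠ p`) is algebraic — the arithmetic twin of the blanket p-adic inputs of rows
D/M: NOT a valid complement of `HC_CM`. On path: implied by `HodgeConjectureQbarAV`. -/
@[conjecture] def SpanLiftingAtOnePrimeAV : Prop :=
  ∀ (A : AbelianVariety ℚal) (r : ℕ)
    (ζ : singularCochainComplex.cocycles ℚ ℚ (ComplexPoints (A.baseChange ℂ).X) (2 * r)),
    IsOfHodgeType A.dim (A.baseChange ℂ).X (2 * r) r r
        (singularCohomology.π ℂ ℂ _ (2 * r) (cocycleOfRat _ (2 * r) ζ)) →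
    (∃ (p : ℕ) (_ : Fact p.Prime) (O : ValuationSubring ℚal)
        (_ : CharP (IsLocalRing.ResidueField O) p)
        (𝒜 : IntegralModel O ℚal A.X), 𝒜.IsSmoothProper A.dim ∧
      ∀ (ℓ : ℕ) [Fact ℓ.Prime] (hℓ : ℓ ≠ p),
        specialisedClass 𝔇 𝒜 r ℓ hℓ ζ ∈ ((𝔇 p O).E₀ ℓ hℓ).algebraicClasses 𝒜.specialFibre r) →
    singularCohomology.π ℂ ℂ _ (2 * r) (cocycleOfRat _ (2 * r) ζ) ∈
      algebraicClasses (A.baseChange ℂ).X r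

/-- INPUT NODE `R₁` — RATIONAL LIFTING AT ONE PRIME (typed neighbour of the p-adic variational
Hodge conjecture [BlochEsnaultKerz2014pAdic, Conj. 2]). A Hodge class on `A/ℚ̄` whose
specialisation at one smooth proper model is, for every `ℓ ≠ p`, the class of an algebraic cycle
with RATIONAL coefficients is algebraic on `A_ℂ`. Differences from print (honest): class-level
conclusion (weaker than BEK's `K₀`-lift), hypothesis "`t` Hodge" added (without it false at a
supersingular fibre), `γ₀` read `ℓ`-adically not crystalline, no `p > dim + 6` proviso.
KIND: complementary to `HC_CM` AS FAR AS PRINT KNOWS — at a supersingular prime of a CM abelian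
variety (all classes weakly Lefschetz) the hypothesis is the prime-to-`p` part of Conjecture B of
[Milne2025AbelianMotivesCharP, §4] (weak rationality; [Milne2009RationalTate, Conj. 4.1] is the
strong form A; Milne 2025 is an unrefereed preprint), whose proof for CM abelian varieties is
conditional there (§4.10 first sentence, §4.16); the node becomes KIND 1 the day B is a theorem.
On path: implied by `HodgeConjectureQbarAV`. -/
@[conjecture] def RationalLiftingAtOnePrimeAV : Prop :=
  ∀ (A : AbelianVariety ℚal) (r : ℕ)
    (ζ : singularCochainComplex.cocycles ℚ ℚ (ComplexPoints (A.baseChange ℂ).X) (2 * r)),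
    IsOfHodgeType A.dim (A.baseChange ℂ).X (2 * r) r r
        (singularCohomology.π ℂ ℂ _ (2 * r) (cocycleOfRat _ (2 * r) ζ)) →
    (∃ (p : ℕ) (_ : Fact p.Prime) (O : ValuationSubring ℚal)
        (_ : CharP (IsLocalRing.ResidueField O) p)
        (𝒜 : IntegralModel O ℚal A.X), 𝒜.IsSmoothProper A.dim ∧
      ∀ (ℓ : ℕ) [Fact ℓ.Prime] (hℓ : ℓ ≠ p),
        specialisedClass 𝔇 𝒜 r ℓ hℓ ζ ∈ ((𝔇 p O).E₀ ℓ hℓ).ratAlgebraicClasses 𝒜.specialFibre r) →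
    singularCohomology.π ℂ ℂ _ (2 * r) (cocycleOfRat _ (2 * r) ζ) ∈
      algebraicClasses (A.baseChange ℂ).X r

/-! ## Kernel theorems -/
variable {𝔇}

/-- `HC_AV ⟹ HC_QbarAV`: apply `HC_AV` to the complexification `A ⊗ ℂ` (same dimension). -/
theorem hodgeConjectureQbarAV_of_HC_AV (h : HC_AV) : HodgeConjectureQbarAV := fun A ↦ by
  simpa only [AbelianVariety.dim_baseChange] using h (A.baseChange ℂ)

/-- ON PATH (C6): the summit statement `HodgeConjecture` implies the endpoint (through `HC_AV`). -/
theorem hodgeConjectureQbarAV_of_hodgeConjecture (h : _root_.HodgeConjecture) :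
    HodgeConjectureQbarAV :=
  hodgeConjectureQbarAV_of_HC_AV fun B ↦ h (AbelianVariety.isSmoothProjective_holds (A := B))

/-- The complexification of an abelian variety over `ℚ̄` has a Hodge model (smooth projective,
`AbelianVariety.isSmoothProjective_holds`; then `nonempty_hodgeModel_holds`). -/
theorem nonempty_hodgeModel_baseChange (A : AbelianVariety ℚal) :
    Nonempty (HodgeModel A.dim (A.baseChange ℂ).X) := by
  simpa only [AbelianVariety.dim_baseChange] using
    nonempty_hodgeModel_holds (AbelianVariety.isSmoothProjective_holds (A := A.baseChange ℂ))

/-- Unfolding `HodgeConjectureFor` on a rational `(r,r)` cocycle. -/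
theorem algebraic_of_hodgeConjectureFor {A : AbelianVariety ℚal} {r : ℕ}
    (h : HodgeConjectureFor A.dim (A.baseChange ℂ).X)
    (ζ : singularCochainComplex.cocycles ℚ ℚ (ComplexPoints (A.baseChange ℂ).X) (2 * r))
    (hH : IsOfHodgeType A.dim (A.baseChange ℂ).X (2 * r) r r
      (singularCohomology.π ℂ ℂ _ (2 * r) (cocycleOfRat _ (2 * r) ζ))) :
    singularCohomology.π ℂ ℂ _ (2 * r) (cocycleOfRat _ (2 * r) ζ) ∈
      algebraicClasses (A.baseChange ℂ).X r :=
  h.2 r _ (isRationalClass_π_cocycleOfRat ζ) hH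

/-- `HodgeConjectureFor A_ℂ` from algebraicity of every rational `(r,r)` cocycle. -/
theorem hodgeConjectureFor_of_forall_cocycle (A : AbelianVariety ℚal)
    (h : ∀ (r : ℕ)
      (ζ : singularCochainComplex.cocycles ℚ ℚ (ComplexPoints (A.baseChange ℂ).X) (2 * r)),
      IsOfHodgeType A.dim (A.baseChange ℂ).X (2 * r) r r
          (singularCohomology.π ℂ ℂ _ (2 * r) (cocycleOfRat _ (2 * r) ζ)) →
      singularCohomology.π ℂ ℂ _ (2 * r) (cocycleOfRat _ (2 * r) ζ) ∈
        algebraicClasses (A.baseChange ℂ).X r) :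
    HodgeConjectureFor A.dim (A.baseChange ℂ).X := by
  refine ⟨nonempty_hodgeModel_baseChange A, fun r c hc hH ↦ ?_⟩
  obtain ⟨ζ, rfl⟩ := (isRationalClass_iff_exists_cocycleOfRat c).1 hc
  exact h r ζ hH

/-- ON PATH: `HC_QbarAV ⟹ L` (the node's conclusion already follows from the Hodge hypothesis). -/
theorem spanLiftingAtAlmostAllPrimesAV_of_hodgeConjectureQbarAV (h : HodgeConjectureQbarAV) :
    SpanLiftingAtAlmostAllPrimesAV 𝔇 := fun A _r ζ hH _ ↦ algebraic_of_hodgeConjectureFor (h A) ζ hH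

/-- ON PATH: `HC_QbarAV ⟹ L₁`. -/
theorem spanLiftingAtOnePrimeAV_of_hodgeConjectureQbarAV (h : HodgeConjectureQbarAV) :
    SpanLiftingAtOnePrimeAV 𝔇 := fun A _r ζ hH _ ↦ algebraic_of_hodgeConjectureFor (h A) ζ hH

/-- ON PATH: `HC_QbarAV ⟹ R₁`. -/
theorem rationalLiftingAtOnePrimeAV_of_hodgeConjectureQbarAV (h : HodgeConjectureQbarAV) :
    RationalLiftingAtOnePrimeAV 𝔇 := fun A _r ζ hH _ ↦ algebraic_of_hodgeConjectureFor (h A) ζ hH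

/-- Rational algebraic classes lie in the `K`-span of algebraic classes (`N • x ∈ Aʳ`, `N ≠ 0`). -/
theorem mem_algebraicClasses_of_mem_ratAlgebraicClasses {F K : Type*} [Field F] [Field K]
    [CharZero K] (W : PreWeilCohomology F K) (Y : SchemeOver F) (r : ℕ) {x : W.obj Y (2 * r)}
    (hx : x ∈ W.ratAlgebraicClasses Y r) : x ∈ W.algebraicClasses Y r := by
  obtain ⟨N, hN, hNx⟩ := hx
  have hmem : (N : K) • x ∈ W.algebraicClasses Y r := by
    rw [Int.cast_smul_eq_zsmul]
    exact Submodule.subset_span hNx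
  have hN' : (N : K) ≠ 0 := Int.cast_ne_zero.2 hN
  simpa [smul_smul, inv_mul_cancel₀ hN'] using Submodule.smul_mem _ (N : K)⁻¹ hmem

/-- LATTICE: `L₁ ⟹ R₁` (a rational cycle class lies in the `ℚ_ℓ`-span of cycle classes). -/
theorem rationalLiftingAtOnePrimeAV_of_spanLiftingAtOnePrimeAV (h : SpanLiftingAtOnePrimeAV 𝔇) :
    RationalLiftingAtOnePrimeAV 𝔇 := by
  intro A r ζ hH hyp
  obtain ⟨p, hp, O, hO, 𝒜, h𝒜, hrat⟩ := hyp
  exact h A r ζ hH ⟨p, hp, O, hO, 𝒜, h𝒜, fun ℓ _ hℓ ↦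
    mem_algebraicClasses_of_mem_ratAlgebraicClasses _ _ r (hrat ℓ hℓ)⟩

/-- **ROW A (span form).** `HC_CM`, the printed junction `hJ : HC_CM → J` ([Milne1999, Thm 7.1] +
[Deligne1982HodgeCycles, 2.9(b)], an explicit hypothesis, NOT a fact) and the span-lifting node at
almost all primes give `HC_QbarAV`; `HC_CM` is load-bearing through Milne's theorem. -/
theorem HC_QbarAV_of_HC_CM_and_spanLifting (𝔇 : RealizationFamily)
    (hJ : HC_CM → SpecialisationsAlgebraicAV 𝔇) (hCM : HC_CM)
    (hL : SpanLiftingAtAlmostAllPrimesAV 𝔇) : HodgeConjectureQbarAV := fun A ↦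
  hodgeConjectureFor_of_forall_cocycle A fun r ζ hH ↦
    hL A r ζ hH ⟨∅, fun p _ _ O _ 𝒜 h𝒜 ℓ _ hℓ ↦ hJ hCM A r ζ hH p O 𝒜 h𝒜 ℓ hℓ⟩

/-- **ROW A, exactness.** Modulo the junctions `hJ` (as above) and `hQC : HC_QbarAV → HC_CM` (CM
abelian varieties are defined over `ℚ̄`, [Shimura1998, §12 Prop. 26], and `HodgeConjectureFor`
is invariant under isomorphism — inline, NOT a fact): `HC_QbarAV ↔ HC_CM ∧ L`. -/
theorem HC_QbarAV_iff_HC_CM_and_spanLifting (𝔇 : RealizationFamily)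
    (hJ : HC_CM → SpecialisationsAlgebraicAV 𝔇) (hQC : HodgeConjectureQbarAV → HC_CM) :
    HodgeConjectureQbarAV ↔ HC_CM ∧ SpanLiftingAtAlmostAllPrimesAV 𝔇 :=
  ⟨fun h ↦ ⟨hQC h, spanLiftingAtAlmostAllPrimesAV_of_hodgeConjectureQbarAV h⟩,
    fun h ↦ HC_QbarAV_of_HC_CM_and_spanLifting 𝔇 hJ h.1 h.2⟩

/-- **ROW A′ (rational form).** `HC_CM`, the special-lift junction `hJ' : HC_CM → J′`
([Milne2009RationalTate, Aside 4.6] + [Kisin2017], explicit hypothesis), the classical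
junction `hgood` and the rational-lifting node at one prime give `HC_QbarAV`. -/
theorem HC_QbarAV_of_HC_CM_and_rationalLifting (𝔇 : RealizationFamily)
    (hJ' : HC_CM → SpecialisationsRationalAV 𝔇)
    (hgood : ∀ A : AbelianVariety ℚal, ∃ F : Finset ℕ, ∀ p : ℕ, p.Prime → p ∉ F →
      ∃ (O : ValuationSubring ℚal) (_ : CharP (IsLocalRing.ResidueField O) p)
        (𝒜 : IntegralModel O ℚal A.X), 𝒜.IsSmoothProper A.dim)
    (hCM : HC_CM) (hR : RationalLiftingAtOnePrimeAV 𝔇) : HodgeConjectureQbarAV := fun A ↦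
  hodgeConjectureFor_of_forall_cocycle A fun r ζ hH ↦ by
    obtain ⟨F, hF⟩ := hJ' hCM A r ζ hH
    obtain ⟨F', hF'⟩ := hgood A
    obtain ⟨p, hle, hp⟩ := Nat.exists_infinite_primes ((F ∪ F').sup id + 1)
    have hpF : p ∉ F ∪ F' := fun hmem ↦ by
      have := Finset.le_sup (f := id) hmem
      simp only [id_eq] at this
      omega
    obtain ⟨O, hO, 𝒜, h𝒜⟩ := hF' p hp (fun hm ↦ hpF (Finset.mem_union_right _ hm))
    haveI : Fact p.Prime := ⟨hp⟩
    exact hR A r ζ hH ⟨p, inferInstance, O, hO, 𝒜, h𝒜, fun ℓ _ hℓ ↦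
      hF p (fun hm ↦ hpF (Finset.mem_union_left _ hm)) O 𝒜 h𝒜 ℓ hℓ⟩

/-- **ROW A′, exactness** modulo `hJ'`, `hgood`, `hQC`: `HC_QbarAV ↔ HC_CM ∧ R₁`. -/
theorem HC_QbarAV_iff_HC_CM_and_rationalLifting (𝔇 : RealizationFamily)
    (hJ' : HC_CM → SpecialisationsRationalAV 𝔇)
    (hgood : ∀ A : AbelianVariety ℚal, ∃ F : Finset ℕ, ∀ p : ℕ, p.Prime → p ∉ F →
      ∃ (O : ValuationSubring ℚal) (_ : CharP (IsLocalRing.ResidueField O) p)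
        (𝒜 : IntegralModel O ℚal A.X), 𝒜.IsSmoothProper A.dim)
    (hQC : HodgeConjectureQbarAV → HC_CM) :
    HodgeConjectureQbarAV ↔ HC_CM ∧ RationalLiftingAtOnePrimeAV 𝔇 :=
  ⟨fun h ↦ ⟨hQC h, rationalLiftingAtOnePrimeAV_of_hodgeConjectureQbarAV h⟩,
    fun h ↦ HC_QbarAV_of_HC_CM_and_rationalLifting 𝔇 hJ' hgood h.1 h.2⟩

/-- **NO-GO (pure kernel).** The single-prime span node proves, WITHOUT `HC_CM`, the Hodge
conjecture for every abelian variety over `ℚ̄` admitting one smooth proper reduction all of whose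
`ℓ`-adic classes are spanned by cycle classes. Every CM abelian variety has such reductions
([SerreTate1968, Thm. 6]; supersingular primes of density ≥ 1/[L:ℚ] by [Shimura1998, §13 Thm. 1]
+ Chebotarev; `LenstraZarhin1993_supersingular_lefschetzClasses_eq_top.algebraicClasses_eq_top`),
so `L₁` gives `HC_CM` up to the descent [Shimura1998, §12 Prop. 26]: KIND 1. -/
theorem algebraic_of_spanLiftingAtOnePrime_of_algebraicClasses_eq_top
    (h : SpanLiftingAtOnePrimeAV 𝔇) (A : AbelianVariety ℚal)
    (hss : ∃ (p : ℕ) (_ : Fact p.Prime) (O : ValuationSubring ℚal)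
        (_ : CharP (IsLocalRing.ResidueField O) p) (𝒜 : IntegralModel O ℚal A.X),
      𝒜.IsSmoothProper A.dim ∧ ∀ (r ℓ : ℕ) [Fact ℓ.Prime] (hℓ : ℓ ≠ p),
        ((𝔇 p O).E₀ ℓ hℓ).algebraicClasses 𝒜.specialFibre r = ⊤) :
    HodgeConjectureFor A.dim (A.baseChange ℂ).X :=
  hodgeConjectureFor_of_forall_cocycle A fun r ζ hH ↦ by
    obtain ⟨p, hp, O, hO, 𝒜, h𝒜, htop⟩ := hss
    exact h A r ζ hH ⟨p, hp, O, hO, 𝒜, h𝒜, fun ℓ _ hℓ ↦ by simp [htop r ℓ hℓ]⟩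

/-- **LINK** (review note on p188036). `PeriodDeficiency.HodgeConjectureQbar` (HC for ALL smooth
projective varieties over `ℚ̄`) gives `HodgeConjectureQbarAV` through `HC_AV`, modulo the refereed
facts [Deligne1982HodgeCycles, Thm. 2.11] and [Voisin2007HodgeLoci, Prop. 1.2, Rem. 1.4]. -/
theorem hodgeConjectureQbarAV_of_hodgeConjectureQbar_of_deligne1982_of_voisin2007
    (hD : deligne1982_hodgeClasses_abelianVariety_absoluteHodge)
    (hV : voisin2007_hodgeConjecture_absolute_of_qbar)
    (hQ : Theses.PeriodDeficiency.HodgeConjectureQbar) : HodgeConjectureQbarAV :=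
  hodgeConjectureQbarAV_of_HC_AV
    (Hypotheses.hc_av_of_deligne_of_voisin_of_absoluteHodgeImpliesAlgebraicQbar hD hV
      fun ι _ _ hX₀ _ _ hc ↦
        mem_algebraicClasses_of_hodgeConjectureFor_of_isAbsoluteHodgeClass (hQ ι hX₀) hc)

end Summit.HodgeConjecture.HodgeConjecture.Ring2.Deform
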